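import Summits.BirchSwinnertonDyer.BirchSwinnertonDyer.Theorems.Rank1ResidualJetCarrierMult
import Summits.BirchSwinnertonDyer.Rank1Residual.JET.IndexTamagawaRecordsKit
import Summits.BirchSwinnertonDyer.BirchSwinnertonDyer.Theorems.Rank1ResidualIntModelSurjectivity
import Literature.NumberTheory.EllipticCurves.Rank1Residual.X9NoEntry
import HarnessLib

/-!
# T1 JET (cell `bsd-jet`), bucket B (carrier `q = p`, `p ∥ N` multiplicative, `p ∣ c_p`): the RECORD
# KIT for the flag-free twin — `BSD(E,p)` for a literal integer model from the bucket-B certificate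
# through `JET.bsdp_of_carrierMultCertificate_level_of_surj` (companion of `Rank1ResidualJetCarrierNeKit`)

HONEST FRAMING (programme file §HONESTY, verbatim): «no tranche here proves BSD; ARM L moves the
LITERAL column of an r ≤ 1 census into the kernel-proved-modulo-named-print column». THEOREMS ONLY
(seat `bsd-jet-pv-2`; `--supports stmt-BirchSwinnertonDyer-14418`, helper). This is the bucket-B twin
of pv-1's `Rank1ResidualJetCarrierNeKit.lean` and of the JET kit `JET.bsdp_of_jetIndexRow_support`
(`Rank1Residual/JET/IndexTamagawaRecordsKit.lean`, seat `bsd-jet-ty`): the FLAGGED class-free input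
`hMJ` (Miller 2011 Thm. 5.4, Cha case) is REPLACED by the READING binder
`hJ : JET.JetchevDivisibilityCarrierMult` (`Rank1ResidualJetDefs.lean`, p463660; audit sheet
`HOME/sheets/PV2-B-GAP.md`) and the PUBLISHED named facts `hMcU` (McCallum 1991 Cor. 5.6), `hKo`
(Kolyvagin), `hrec` (Shimura reciprocity at conductor 1), `hD36` (Darmon 2004 Thm. 3.6), `hlev`
(Carayol), `hGZK` (bsd.S17). A row supplies, besides the model and the Heegner datum of the JET kit
(`K` with `d_K ∉ {−3, −4}`, `N`, `P`, the two-engine index line `hI : ord_p [E(K):ℤP] ≤ ord_p c_p` at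
the carrier `p` ITSELF, `r_an ≤ 1`, `#Ш_an = s` a `p`-unit): `p ∣ Δ`, `p ∤ c₄` (MULTIPLICATIVE at `p` —
the register's bucket B is split `I_n` at `p`, `p ∣ n`), and an IMAGE certificate decided in the
kernel —
* `bsdp_of_jetRowCarrierMult_of_serreWitnesses` (`p ≥ 5`): three Frobenius witnesses `ℓ₁, ℓ₂, ℓ₃` of
  good reduction whose point counts give Serre's Prop. 19 conditions, so `ρ̄_{E,p}` is ONTO
  (`IntModel.hasSurjectiveModNGaloisRep_of_intModel_of_serreWitnesses`);
* `bsdp_of_jetRowCarrierMult_of_ram` (any odd `p`, so `p = 3 ∥ N` included): ONE Frobenius witness for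
  `Irr` (Mazur 1978 Prop. 6.3 (1)) and ONE (ram) witness `m ≠ p` multiplicative with `p ∤ v_m(Δ)`
  (⇒ `ρ̄_{E,p}` onto, `surj_of_irr_of_ram`).
In both the `p`-adic tower is DISCHARGED in the kernel from `ρ̄_{E,p}` onto at the multiplicative `p`
(Tate line, `forall_hasSurjectiveModNGaloisRep_pow_of_multiplicative_of_surj`, inside
`JET.bsdp_of_carrierMultCertificate_of_surj`); no `¬CM` witness (multiplicative reduction excludes CM);
no `p ∤ d_K`, no `p² ∤ N`. Per pair; no class statement; nothing about any particular curve is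
asserted; CONDITIONAL on the reading binder `hJ` and every published binder — what a record through
this kit is worth is referee A's word on the reading (sheet §2: bucket B differs from bucket A at
exactly one printed line, Prop. 4.9 at `v ∣ p`, which is the x11b3 tree theorem
`X11b.Three.JetchevKummer.localKummerMap_mem_connectedKummerCondition_padic_of_cocycle`).
PARTITION: row D5 `JET@p∣N` bucket B (72 249 literal classes) — 0 moved by this file.

References: [Jetchev2008] Thm. 1.4, Cor. 1.5 (p. 812); [Serre1972] §2.8 Prop. 19, §2.4 Prop. 15;
[Mazur1978] Prop. 6.3 (1); [SilvermanAEC2009] VII.1, VII.5.1(b), VIII.8; [Kraus1989] Prop. 1–2;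
[Wuthrich2014] Lemma 20; [Miller2011LMS] Def. 1.1.
-/

set_option autoImplicit false

noncomputable section

open scoped Classical

open WeierstrassCurve Literature.NumberTheory.EllipticCurves
  Literature.NumberTheory.EllipticCurves.ModularForms
  Literature.NumberTheory.EllipticCurves.Rank1Residual
  Literature.NumberTheory.EllipticCurves.Rank1Residual.X11RankOneCertificates
  Summit.BirchSwinnertonDyer.BirchSwinnertonDyer.Rank1Residual
  Summit.BirchSwinnertonDyer.BirchSwinnertonDyer.Rank1Residual.IntModel
  Summit.BirchSwinnertonDyer.BirchSwinnertonDyer.Rank1Residual.X11RankOne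
  Summit.BirchSwinnertonDyer.Rank1Residual Summit.BirchSwinnertonDyer.Rank1Residual.X11b

namespace Summit.BirchSwinnertonDyer.Rank1Residual.JET

/-- **`BSD(E,p)`, `p ≥ 5`, for a literal integer model from the bucket-B certificate (carrier `p`),
image by three Serre witnesses** (support-form Kraus minimality). Kernel inputs (`decide` goals for a
record): `Δ ≠ 0`; the support `bad` of `Δ` with the per-prime Kraus test (⇒ `IsGloballyMinimal`);
`p ∣ Δ`, `p ∤ c₄` (MULTIPLICATIVE at `p`); three good primes `ℓ₁, ℓ₂, ℓ₃ ≠ p` with point counts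
`n₁, n₂, n₃` giving Serre's Prop. 19 conditions (split / non-split / `u`) ⇒ `ρ̄_{E,p}` onto. Displayed
binders: the READING `hJ : JetchevDivisibilityCarrierMult` and the published `hMcU`, `hGZK`, `hKo`,
`hrec`, `hD36`, `hlev`; the Heegner datum (`K` with `d_K ∉ {−3,−4}`, `N`, `P`), the certificate line
`ord_p [E(K):ℤP] ≤ ord_p c_p` AT THE CARRIER `p`, `r_an ≤ 1`, `#Ш_an = s` with `ord_p s = 0`. Output:
`BSDp W p` via `JET.bsdp_of_carrierMultCertificate_level_of_surj` (the `p`-adic tower discharged in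
the kernel at the multiplicative `p`). CONDITIONAL on every binder; per pair.
[cite: Jetchev2008, Cor. 1.5 (p. 812)] [cite: Serre1972, §2.8 Prop. 19]
[cite: Kraus1989, Prop. 1 and Prop. 2] [cite: SilvermanAEC2009, VII.1 Remark 1.1, VII.5 Prop. 5.1(b) and VIII.8]
[cite: Wuthrich2014, Lemma 20 (p. 399)] [cite: Miller2011LMS, Def. 1.1] -/
theorem bsdp_of_jetRowCarrierMult_of_serreWitnesses (p : ℕ) (hp : p.Prime) (h5 : 5 ≤ p)
    (a1 a2 a3 a4 a6 : ℤ)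
    (h0 : discOf [a1, a2, a3, a4, a6] ≠ 0) (bad : List (ℕ × ℕ × ℕ)) (hprime : ∀ t ∈ bad, t.1.Prime)
    (hsupp : (discOf [a1, a2, a3, a4, a6]).natAbs = (bad.map fun t => t.1 ^ t.2.2).prod)
    (hmin : ∀ t ∈ bad,
      (¬ (t.1 : ℤ) ^ 12 ∣ discOf [a1, a2, a3, a4, a6] ∨ ¬ (t.1 : ℤ) ^ 4 ∣ c4Of [a1, a2, a3, a4, a6]) ∨
      (t.1 = 2 ∧ (16 : ℤ) ∣ c4Of [a1, a2, a3, a4, a6] ∧ (64 : ℤ) ∣ c6Of [a1, a2, a3, a4, a6] ∧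
        ¬ (((16 : ℤ) ∣ c4Of [a1, a2, a3, a4, a6] / 16 ∧
            ((32 : ℤ) ∣ c6Of [a1, a2, a3, a4, a6] / 64 ∨ (32 : ℤ) ∣ c6Of [a1, a2, a3, a4, a6] / 64 - 8)) ∨
          (4 : ℤ) ∣ c6Of [a1, a2, a3, a4, a6] / 64 + 1)) ∨
      (t.1 = 3 ∧ (3 : ℤ) ^ 8 ∣ c6Of [a1, a2, a3, a4, a6] ∧ ¬ (3 : ℤ) ^ 9 ∣ c6Of [a1, a2, a3, a4, a6]))
    (hpΔ : (p : ℤ) ∣ (⟨a1, a2, a3, a4, a6⟩ : WeierstrassCurve ℤ).Δ)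
    (hpc₄ : ¬ (p : ℤ) ∣ (⟨a1, a2, a3, a4, a6⟩ : WeierstrassCurve ℤ).c₄)
    (ℓ₁ ℓ₂ ℓ₃ : ℕ) (hℓ₁ : ℓ₁.Prime) (hℓ₂ : ℓ₂.Prime) (hℓ₃ : ℓ₃.Prime)
    (h2ℓ₁ : ℓ₁ ≠ 2) (h2ℓ₂ : ℓ₂ ≠ 2) (h2ℓ₃ : ℓ₃ ≠ 2) (hℓ₁p : ℓ₁ ≠ p) (hℓ₂p : ℓ₂ ≠ p) (hℓ₃p : ℓ₃ ≠ p)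
    (hΔ₁ : ¬ (ℓ₁ : ℤ) ∣ (⟨a1, a2, a3, a4, a6⟩ : WeierstrassCurve ℤ).Δ)
    (hΔ₂ : ¬ (ℓ₂ : ℤ) ∣ (⟨a1, a2, a3, a4, a6⟩ : WeierstrassCurve ℤ).Δ)
    (hΔ₃ : ¬ (ℓ₃ : ℤ) ∣ (⟨a1, a2, a3, a4, a6⟩ : WeierstrassCurve ℤ).Δ)
    {n₁ n₂ n₃ : ℕ} (hc₁ : countPoints [a1, a2, a3, a4, a6] ℓ₁ = n₁)
    (hc₂ : countPoints [a1, a2, a3, a4, a6] ℓ₂ = n₂) (hc₃ : countPoints [a1, a2, a3, a4, a6] ℓ₃ = n₃)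
    (hi : IsSquare ((((ℓ₁ : ℤ) + 1 - n₁ : ℤ) : ZMod p) ^ 2 - 4 * ℓ₁) ∧
      (((ℓ₁ : ℤ) + 1 - n₁ : ℤ) : ZMod p) ^ 2 - 4 * ℓ₁ ≠ 0 ∧ (((ℓ₁ : ℤ) + 1 - n₁ : ℤ) : ZMod p) ≠ 0)
    (hii : ¬ IsSquare ((((ℓ₂ : ℤ) + 1 - n₂ : ℤ) : ZMod p) ^ 2 - 4 * ℓ₂) ∧
      (((ℓ₂ : ℤ) + 1 - n₂ : ℤ) : ZMod p) ≠ 0)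
    (hiii : ∃ u : ZMod p, (((ℓ₃ : ℤ) + 1 - n₃ : ℤ) : ZMod p) ^ 2 = u * ℓ₃ ∧
      u ≠ 0 ∧ u ≠ 1 ∧ u ≠ 2 ∧ u ≠ 4 ∧ u ^ 2 - 3 * u + 1 ≠ 0)
    (hJ : JetchevDivisibilityCarrierMult)
    (hMcU : McCallum1991_padicValNat_card_sha_primary_add_le_of_globalDivisibility)
    (hGZK : rank_eq_analyticRank_of_analyticRank_le_one)
    (hKo : ∀ (N : ℕ) [NeZero N] (W : WeierstrassCurve ℚ) (K : Type) [Field K] [NumberField K],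
      kolyvagin N W K)
    (hrec : ∀ (N : ℕ) [NeZero N] (W : WeierstrassCurve ℚ) (K : Type) [Field K] [NumberField K],
      heegnerPointOfConductor_one_galoisConj N W K)
    (hD36 : ∀ (N : ℕ) [NeZero N] (W : WeierstrassCurve ℚ) (K : Type) [Field K] [NumberField K],
      phi_heegnerTau_mem_singularModuliField N W K)
    (hlev : ∀ {N : ℕ} [NeZero N], IsNewformOf.level_eq_conductorNorm (N := N))
    (W : WeierstrassCurve ℚ) (hW : W = ⟨a1, a2, a3, a4, a6⟩)
    {N : ℕ} [NeZero N] {K : Type} [Field K] [NumberField K] (hK : IsImaginaryQuadratic K)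
    (hD3 : NumberField.discr K ≠ -3) (hD4 : NumberField.discr K ≠ -4)
    (hH : SatisfiesHeegnerHypothesis N K) {P : (W.baseChange K).toAffine.Point}
    (hP : IsHeegnerPoint N W K P) (hnt : ¬ IsOfFinAddOrder P)
    (hI : (haveI := Fact.mk hp;
      padicValNat p (AddSubgroup.zmultiples P).index ≤
        padicValNat p ((W.baseChange ℚ_[p]).localTamagawaNumber ℤ_[p])))
    (hr : W.analyticRank ≤ 1) {s : ℚ} (hs : shaAn W = (s : ℂ)) (hv : padicValRat p s = 0) :
    BSDp W p := by
  subst hW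
  haveI hE : (⟨a1, a2, a3, a4, a6⟩ : WeierstrassCurve ℚ).IsElliptic :=
    X11b.isElliptic_of_discOf_ne_zero a1 a2 a3 a4 a6 h0
  haveI hM : (⟨a1, a2, a3, a4, a6⟩ : WeierstrassCurve ℚ).IsGloballyMinimal :=
    X11b.isGloballyMinimal_of_krausCriterion_support a1 a2 a3 a4 a6 bad hprime hsupp hmin
  haveI : Fact (Nat.Prime p) := ⟨hp⟩
  haveI := Fact.mk hℓ₁; haveI := Fact.mk hℓ₂; haveI := Fact.mk hℓ₃
  have hI0 : integralModelInt (⟨a1, a2, a3, a4, a6⟩ : WeierstrassCurve ℚ) = ⟨a1, a2, a3, a4, a6⟩ :=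
    integralModelInt_eq_of_map_eq _ (map_mk_int a1 a2 a3 a4 a6)
  -- the three witness counts in `Nat.card` form
  have hn₁ : Nat.card (((⟨a1, a2, a3, a4, a6⟩ : WeierstrassCurve ℤ).map
      (Int.castRingHom (ZMod ℓ₁))).toAffine.Point) = n₁ := by
    exact_mod_cast (X11b.natCard_point_eq_countPoints a1 a2 a3 a4 a6 ℓ₁ h2ℓ₁ hΔ₁).trans hc₁
  have hn₂ : Nat.card (((⟨a1, a2, a3, a4, a6⟩ : WeierstrassCurve ℤ).map
      (Int.castRingHom (ZMod ℓ₂))).toAffine.Point) = n₂ := by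
    exact_mod_cast (X11b.natCard_point_eq_countPoints a1 a2 a3 a4 a6 ℓ₂ h2ℓ₂ hΔ₂).trans hc₂
  have hn₃ : Nat.card (((⟨a1, a2, a3, a4, a6⟩ : WeierstrassCurve ℤ).map
      (Int.castRingHom (ZMod ℓ₃))).toAffine.Point) = n₃ := by
    exact_mod_cast (X11b.natCard_point_eq_countPoints a1 a2 a3 a4 a6 ℓ₃ h2ℓ₃ hΔ₃).trans hc₃
  -- `ρ̄_{E,p}` onto (Serre 1972 Prop. 19)
  have hsurj : (⟨a1, a2, a3, a4, a6⟩ : WeierstrassCurve ℚ).HasSurjectiveModNGaloisRep p :=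
    hasSurjectiveModNGaloisRep_of_intModel_of_serreWitnesses hI0 p h5 ℓ₁ ℓ₂ ℓ₃ hℓ₁p hℓ₂p hℓ₃p hΔ₁
      hΔ₂ hΔ₃ hn₁ hn₂ hn₃ hi hii hiii
  -- multiplicative at `p` (the carrier)
  have hmult : (⟨a1, a2, a3, a4, a6⟩ : WeierstrassCurve ℚ).HasMultiplicativeReductionAtPrime p :=
    hasMultiplicativeReductionAtPrime_of_intModel hI0 p hpΔ hpc₄
  exact bsdp_of_carrierMultCertificate_level_of_surj hJ hMcU hGZK hKo hrec hD36 hlev _ p hK hD3 hD4 hH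
    hP hnt (by omega) hmult hsurj hI hr hs hv

/-- **`BSD(E,p)` at an odd MULTIPLICATIVE `p ∥ N` (so `p = 3 ∥ N` included) for a literal integer
model from the bucket-B certificate (carrier `p`), image by ONE Frobenius witness and ONE (ram)
witness** (support-form Kraus minimality). Kernel inputs: `Δ ≠ 0`; the support `bad` of `Δ` with the
per-prime Kraus test; `p ∣ Δ`, `p ∤ c₄` (multiplicative at `p`); a good prime `ℓ ∉ {2, p}` with point
count `n` and `X² − (ℓ + 1 − n)X + ℓ` without a root in `𝔽_p` (⇒ `E[p]` irreducible, Mazur 1978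
Prop. 6.3 (1)); a prime `m ≠ p` with `m ∣ Δ`, `m ∤ c₄`, `mᵉ ∥ Δ`, `p ∤ e` (a (ram) witness ⇒ `ρ̄_{E,p}`
onto, `surj_of_irr_of_ram`); the tower by the Tate line (inside `JET.bsdp_of_carrierMultCertificate_of_surj`).
Displayed binders as in `bsdp_of_jetRowCarrierMult_of_serreWitnesses`. CONDITIONAL on every binder;
per pair. [cite: Jetchev2008, Cor. 1.5 (p. 812)] [cite: Mazur1978, §6 Prop. 6.3 (1) (p. 153)]
[cite: Serre1972, §2.4 Prop. 15] [cite: Wuthrich2014, Lemma 20 (p. 399)]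
[cite: SilvermanAEC2009, VII.5 Prop. 5.1(b) and VIII.8] [cite: Miller2011LMS, Def. 1.1] -/
theorem bsdp_of_jetRowCarrierMult_of_ram (p : ℕ) (hp : p.Prime) (hp2 : p ≠ 2)
    (a1 a2 a3 a4 a6 : ℤ)
    (h0 : discOf [a1, a2, a3, a4, a6] ≠ 0) (bad : List (ℕ × ℕ × ℕ)) (hprime : ∀ t ∈ bad, t.1.Prime)
    (hsupp : (discOf [a1, a2, a3, a4, a6]).natAbs = (bad.map fun t => t.1 ^ t.2.2).prod)
    (hmin : ∀ t ∈ bad,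
      (¬ (t.1 : ℤ) ^ 12 ∣ discOf [a1, a2, a3, a4, a6] ∨ ¬ (t.1 : ℤ) ^ 4 ∣ c4Of [a1, a2, a3, a4, a6]) ∨
      (t.1 = 2 ∧ (16 : ℤ) ∣ c4Of [a1, a2, a3, a4, a6] ∧ (64 : ℤ) ∣ c6Of [a1, a2, a3, a4, a6] ∧
        ¬ (((16 : ℤ) ∣ c4Of [a1, a2, a3, a4, a6] / 16 ∧
            ((32 : ℤ) ∣ c6Of [a1, a2, a3, a4, a6] / 64 ∨ (32 : ℤ) ∣ c6Of [a1, a2, a3, a4, a6] / 64 - 8)) ∨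
          (4 : ℤ) ∣ c6Of [a1, a2, a3, a4, a6] / 64 + 1)) ∨
      (t.1 = 3 ∧ (3 : ℤ) ^ 8 ∣ c6Of [a1, a2, a3, a4, a6] ∧ ¬ (3 : ℤ) ^ 9 ∣ c6Of [a1, a2, a3, a4, a6]))
    (hpΔ : (p : ℤ) ∣ (⟨a1, a2, a3, a4, a6⟩ : WeierstrassCurve ℤ).Δ)
    (hpc₄ : ¬ (p : ℤ) ∣ (⟨a1, a2, a3, a4, a6⟩ : WeierstrassCurve ℤ).c₄)
    (ℓ : ℕ) (hℓ : ℓ.Prime) (h2ℓ : ℓ ≠ 2) (hℓp : ℓ ≠ p)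
    (hΔℓ : ¬ (ℓ : ℤ) ∣ (⟨a1, a2, a3, a4, a6⟩ : WeierstrassCurve ℤ).Δ)
    {n : ℕ} (hc : countPoints [a1, a2, a3, a4, a6] ℓ = n)
    (hnoroot : ∀ t : ZMod p, t ^ 2 - (((ℓ : ℤ) + 1 - n : ℤ) : ZMod p) * t + (ℓ : ZMod p) ≠ 0)
    (m : ℕ) (hm : m.Prime) (hmp : m ≠ p) (hmΔ : (m : ℤ) ∣ (⟨a1, a2, a3, a4, a6⟩ : WeierstrassCurve ℤ).Δ)
    (hmc₄ : ¬ (m : ℤ) ∣ (⟨a1, a2, a3, a4, a6⟩ : WeierstrassCurve ℤ).c₄) {e : ℕ}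
    (hme : (m : ℤ) ^ e ∣ (⟨a1, a2, a3, a4, a6⟩ : WeierstrassCurve ℤ).Δ)
    (hme' : ¬ (m : ℤ) ^ (e + 1) ∣ (⟨a1, a2, a3, a4, a6⟩ : WeierstrassCurve ℤ).Δ) (hpe : ¬ p ∣ e)
    (hJ : JetchevDivisibilityCarrierMult)
    (hMcU : McCallum1991_padicValNat_card_sha_primary_add_le_of_globalDivisibility)
    (hGZK : rank_eq_analyticRank_of_analyticRank_le_one)
    (hKo : ∀ (N : ℕ) [NeZero N] (W : WeierstrassCurve ℚ) (K : Type) [Field K] [NumberField K],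
      kolyvagin N W K)
    (hrec : ∀ (N : ℕ) [NeZero N] (W : WeierstrassCurve ℚ) (K : Type) [Field K] [NumberField K],
      heegnerPointOfConductor_one_galoisConj N W K)
    (hD36 : ∀ (N : ℕ) [NeZero N] (W : WeierstrassCurve ℚ) (K : Type) [Field K] [NumberField K],
      phi_heegnerTau_mem_singularModuliField N W K)
    (hlev : ∀ {N : ℕ} [NeZero N], IsNewformOf.level_eq_conductorNorm (N := N))
    (W : WeierstrassCurve ℚ) (hW : W = ⟨a1, a2, a3, a4, a6⟩)
    {N : ℕ} [NeZero N] {K : Type} [Field K] [NumberField K] (hK : IsImaginaryQuadratic K)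
    (hD3 : NumberField.discr K ≠ -3) (hD4 : NumberField.discr K ≠ -4)
    (hH : SatisfiesHeegnerHypothesis N K) {P : (W.baseChange K).toAffine.Point}
    (hP : IsHeegnerPoint N W K P) (hnt : ¬ IsOfFinAddOrder P)
    (hI : (haveI := Fact.mk hp;
      padicValNat p (AddSubgroup.zmultiples P).index ≤
        padicValNat p ((W.baseChange ℚ_[p]).localTamagawaNumber ℤ_[p])))
    (hr : W.analyticRank ≤ 1) {s : ℚ} (hs : shaAn W = (s : ℂ)) (hv : padicValRat p s = 0) :
    BSDp W p := by
  subst hW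
  haveI hE : (⟨a1, a2, a3, a4, a6⟩ : WeierstrassCurve ℚ).IsElliptic :=
    X11b.isElliptic_of_discOf_ne_zero a1 a2 a3 a4 a6 h0
  haveI hM : (⟨a1, a2, a3, a4, a6⟩ : WeierstrassCurve ℚ).IsGloballyMinimal :=
    X11b.isGloballyMinimal_of_krausCriterion_support a1 a2 a3 a4 a6 bad hprime hsupp hmin
  haveI : Fact (Nat.Prime p) := ⟨hp⟩
  haveI := Fact.mk hℓ
  have hI0 : integralModelInt (⟨a1, a2, a3, a4, a6⟩ : WeierstrassCurve ℚ) = ⟨a1, a2, a3, a4, a6⟩ :=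
    integralModelInt_eq_of_map_eq _ (map_mk_int a1 a2 a3 a4 a6)
  have hn : Nat.card (((⟨a1, a2, a3, a4, a6⟩ : WeierstrassCurve ℤ).map
      (Int.castRingHom (ZMod ℓ))).toAffine.Point) = n := by
    exact_mod_cast (X11b.natCard_point_eq_countPoints a1 a2 a3 a4 a6 ℓ h2ℓ hΔℓ).trans hc
  -- `E[p]` irreducible (Mazur 1978 Prop. 6.3 (1)) and a (ram) witness ⇒ `ρ̄_{E,p}` onto
  have hirr : Irr (⟨a1, a2, a3, a4, a6⟩ : WeierstrassCurve ℚ) p :=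
    hasIrreducibleModPGaloisRep_of_intModel_of_noroot hI0 p ℓ hℓp hΔℓ hn hnoroot
  have hram : Ram (⟨a1, a2, a3, a4, a6⟩ : WeierstrassCurve ℚ) p :=
    ram_of_intModel hI0 p m hm hmp hmΔ hmc₄ hme hme' hpe
  have hsurj : Surj (⟨a1, a2, a3, a4, a6⟩ : WeierstrassCurve ℚ) p :=
    surj_of_irr_of_ram _ p hirr hram
  -- multiplicative at `p`
  have hmult : (⟨a1, a2, a3, a4, a6⟩ : WeierstrassCurve ℚ).HasMultiplicativeReductionAtPrime p :=
    hasMultiplicativeReductionAtPrime_of_intModel hI0 p hpΔ hpc₄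
  exact bsdp_of_carrierMultCertificate_level_of_surj hJ hMcU hGZK hKo hrec hD36 hlev _ p hK hD3 hD4 hH
    hP hnt hp2 hmult hsurj hI hr hs hv

end Summit.BirchSwinnertonDyer.Rank1Residual.JET

end
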